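import Mathlib
import Summits.NavierStokesRegularity.NavierStokesRegularity.Theorems.ThreadingFluxHorizonTowerDefs
import Summits.NavierStokesRegularity.NavierStokesRegularity.Theorems.ThreadingFluxHorizonTowerFiniteTowerToolkit
import Summits.NavierStokesRegularity.NavierStokesRegularity.Theorems.ThreadingFluxLoopLawSameDegreeBracketRigidity
import Summits.NavierStokesRegularity.NavierStokesRegularity.Theorems.ThreadingFluxHorizonTowerZonalBridge
import Summits.NavierStokesRegularity.NavierStokesRegularity.Theorems.ThreadingFluxHorizonTowerL2ClosedForm
import HarnessLib

/-!
# Crux `PoloidalLiouville` (stmt-NavierStokesRegularity-1222), crux idea «horizon-threading-tower» (ns-idea-15):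
# ZONAL UNIQUENESS — two shells of the same degree zonal about the same axis are proportional

Support file (`--supports stmt-NavierStokesRegularity-1222`, helper; cell `ns-wall-extremal`, width hand ns-wall-eng-3 g3; 0 kit;
director key 04:06:45Z (a)-toolkit).  ★ `zonal_unique`: if `Y ≠ 0` and `Z` are smooth, homogeneous of degree `l`, harmonic, and
both infinitesimally zonal about `a ≠ 0` (`⟪a × x, ∇Y(x)⟫ = 0 = ⟪a × x, ∇Z(x)⟫`), then `Z = c·Y`.  Proof: coaxial zonal shells
Poisson-commute off the axis (`bracket_of_coaxial_zonal`, the factor `|a × x|²`), hence everywhere by continuity along `x + t b`;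
then SAME-DEGREE BRACKET RIGIDITY (`LoopLaw.sameDegreeBracketRigidityAt_all`, p684047) on the polynomials of
`Zonal.exists_mvPolynomial_of_homogeneous`.  So the zonal harmonics of each degree form a line — the «Legendre axis» a successor
needs to make zonal shells explicit in the finite-tower induction.

HONEST LABEL: elementary; no sketch Prop closed; `HorizonTowerZonality`, `PoloidalLiouville` (1222) OPEN; NS regularity NOT proved.
-/

-- the summit and its single sub-problem share the name (CONVENTIONS §1)
set_option linter.dupNamespace false

noncomputable section

namespace Summit.NavierStokesRegularity.NavierStokesRegularity.Theorems.PoloidalLiouville.HorizonTower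

open Set Function Filter Topology Metric
open scoped Topology RealInnerProductSpace
open Literature.Analysis.FluidPDE
open Literature.Geometry.DiscreteGeometry (inner_fin3 norm_sq_fin3)

section ZonalUnique

/-- For `a ≠ 0` there is a coordinate vector `b` with `a × b ≠ 0`. -/
theorem exists_cross_ne_zero {a : E3} (ha : a ≠ 0) : ∃ b : E3, cross a b ≠ 0 := by
  by_contra h
  push Not at h
  have h0 := h (EuclideanSpace.single 0 1)
  have h1 := h (EuclideanSpace.single 1 1)
  obtain ⟨c0, c1, c2⟩ := cross_fin3 a (EuclideanSpace.single 0 1)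
  obtain ⟨d0, d1, d2⟩ := cross_fin3 a (EuclideanSpace.single 1 1)
  have e1 : a 2 = 0 := by
    have := congrArg (fun v : E3 => v 1) h0
    simp only [PiLp.zero_apply] at this
    rw [c1] at this; simpa [PiLp.single_apply] using this
  have e2 : a 1 = 0 := by
    have := congrArg (fun v : E3 => v 2) h0
    simp only [PiLp.zero_apply] at this
    rw [c2] at this; simpa [PiLp.single_apply] using this
  have e0 : a 0 = 0 := by
    have := congrArg (fun v : E3 => v 2) h1
    simp only [PiLp.zero_apply] at this
    rw [d2] at this; simpa [PiLp.single_apply] using this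
  apply ha
  ext i
  fin_cases i <;> simp [e0, e1, e2]

/-- **Coaxial zonal functions Poisson-commute everywhere** (continuity across the axis): if `Y`, `Z` are `C¹` with
`⟪a × x, ∇Y(x)⟫ = 0 = ⟪a × x, ∇Z(x)⟫` for all `x` and `a ≠ 0`, then `⟪x, ∇Y(x) × ∇Z(x)⟫ = 0` for all `x`. -/
theorem bracket_eq_zero_of_coaxial_zonal {Y Z : E3 → ℝ} {a : E3} (ha : a ≠ 0)
    (hY : Continuous (gradient Y)) (hZ : Continuous (gradient Z))
    (hYz : ∀ x : E3, ⟪cross a x, gradient Y x⟫ = 0) (hZz : ∀ x : E3, ⟪cross a x, gradient Z x⟫ = 0) (x : E3) :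
    ⟪x, cross (gradient Y x) (gradient Z x)⟫ = 0 := by
  set B : E3 → ℝ := fun w => ⟪w, cross (gradient Y w) (gradient Z w)⟫ with hB
  -- `B` is continuous
  have hBc : Continuous B := by
    have hc : Continuous fun w : E3 => cross (gradient Y w) (gradient Z w) := by
      have : (fun w : E3 => cross (gradient Y w) (gradient Z w)) = fun w => crossCLM (gradient Y w) (gradient Z w) := by
        funext w; rw [crossCLM_apply]
      rw [this]
      exact crossCLM.continuous₂.comp (hY.prodMk hZ)
    exact continuous_id.inner hc
  -- `B` vanishes off the axis
  have hoff : ∀ w : E3, cross a w ≠ 0 → B w = 0 := by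
    intro w hw
    have h := bracket_of_coaxial_zonal (hYz w) (hZz w)
    have hn : ‖cross a w‖ ^ 2 ≠ 0 := pow_ne_zero _ (norm_ne_zero_iff.mpr hw)
    exact (mul_eq_zero.1 h).resolve_left hn
  -- approach `x` along `x + t b` with `a × b ≠ 0`
  obtain ⟨b, hb⟩ := exists_cross_ne_zero ha
  by_cases hx : cross a x ≠ 0
  · exact hoff x hx
  · push Not at hx
    have hline : ∀ t : ℝ, t ≠ 0 → B (x + t • b) = 0 := by
      intro t ht
      apply hoff
      rw [← crossCLM_apply, map_add, map_smul, crossCLM_apply, crossCLM_apply, hx, zero_add]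
      exact smul_ne_zero ht hb
    -- the limit along `t → 0`, `t ≠ 0`
    have hpath : Tendsto (fun t : ℝ => x + t • b) (𝓝[≠] 0) (𝓝 x) := by
      have : Tendsto (fun t : ℝ => x + t • b) (𝓝 0) (𝓝 (x + (0 : ℝ) • b)) :=
        (continuous_const.add (continuous_id.smul continuous_const)).continuousAt.tendsto
      rw [zero_smul, add_zero] at this
      exact this.mono_left nhdsWithin_le_nhds
    have hlim : Tendsto (fun t : ℝ => B (x + t • b)) (𝓝[≠] 0) (𝓝 (B x)) := (hBc.tendsto x).comp hpath
    have hzero : Tendsto (fun t : ℝ => B (x + t • b)) (𝓝[≠] 0) (𝓝 0) := by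
      refine tendsto_const_nhds.congr' ?_
      filter_upwards [self_mem_nhdsWithin] with t ht
      exact (hline t ht).symm
    exact tendsto_nhds_unique hlim hzero

/-- ★ **ZONAL UNIQUENESS PER DEGREE**: two smooth, degree-`l` homogeneous, harmonic functions that are infinitesimally zonal about the
same axis `a ≠ 0` are proportional (if the first is not identically zero). -/
theorem zonal_unique (l : ℕ) (Y Z : E3 → ℝ) {a : E3} (ha : a ≠ 0)
    (hY : ContDiff ℝ (⊤ : ℕ∞) Y) (hhomY : ∀ (c : ℝ) (y : E3), Y (c • y) = c ^ l * Y y)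
    (hharmY : ∀ y, Laplacian.laplacian Y y = 0)
    (hZ : ContDiff ℝ (⊤ : ℕ∞) Z) (hhomZ : ∀ (c : ℝ) (y : E3), Z (c • y) = c ^ l * Z y)
    (hharmZ : ∀ y, Laplacian.laplacian Z y = 0)
    (hYz : ∀ x : E3, ⟪cross a x, gradient Y x⟫ = 0) (hZz : ∀ x : E3, ⟪cross a x, gradient Z x⟫ = 0)
    (hY0 : ∃ y, Y y ≠ 0) :
    ∃ c : ℝ, ∀ y : E3, Z y = c * Y y := by
  classical
  -- the bracket vanishes everywhere
  have hgY : Continuous (gradient Y) := (OrderTwo.contDiff_gradient (n := 0) (hY.of_le (by norm_cast))).continuous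
  have hgZ : Continuous (gradient Z) := (OrderTwo.contDiff_gradient (n := 0) (hZ.of_le (by norm_cast))).continuous
  have hbr : ∀ x : E3, ⟪x, cross (gradient Y x) (gradient Z x)⟫ = 0 :=
    bracket_eq_zero_of_coaxial_zonal ha hgY hgZ hYz hZz
  -- polynomials
  obtain ⟨p, hp, hYp⟩ := Zonal.exists_mvPolynomial_of_homogeneous hY hhomY
  obtain ⟨q, hq, hZq⟩ := Zonal.exists_mvPolynomial_of_homogeneous hZ hhomZ
  have hYfun : Y = fun y : E3 => MvPolynomial.eval (fun i => y i) p := funext hYp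
  have hZfun : Z = fun y : E3 => MvPolynomial.eval (fun i => y i) q := funext hZq
  have hp0 : p ≠ 0 := by
    rintro rfl
    obtain ⟨y, hy⟩ := hY0
    exact hy (by rw [hYp]; simp [Zonal.evalE])
  have hpl : ∀ y : E3, Laplacian.laplacian (fun y : E3 => MvPolynomial.eval (fun i => y i) p) y = 0 := by
    intro y; rw [← hYfun]; exact hharmY y
  have hql : ∀ y : E3, Laplacian.laplacian (fun y : E3 => MvPolynomial.eval (fun i => y i) q) y = 0 := by
    intro y; rw [← hZfun]; exact hharmZ y
  have hbr' : ∀ y : E3, inner ℝ y (cross (gradient (fun y : E3 => MvPolynomial.eval (fun i => y i) p) y)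
      (gradient (fun y : E3 => MvPolynomial.eval (fun i => y i) q) y)) = 0 := by
    intro y; rw [← hYfun, ← hZfun]; exact hbr y
  obtain ⟨c, hc⟩ := LoopLaw.sameDegreeBracketRigidityAt_all l p q ⟨hp, hpl⟩ ⟨hq, hql⟩ hp0 hbr'
  refine ⟨c, fun y => ?_⟩
  rw [hZq, hYp]
  simp only [Zonal.evalE, hc, MvPolynomial.smul_eval]

end ZonalUnique

end Summit.NavierStokesRegularity.NavierStokesRegularity.Theorems.PoloidalLiouville.HorizonTower

end
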